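import Summits.ABC.IUTFork.Cor312LicenceCellThreshold
import Summits.ABC.IUTFork.Repair.CandInternal2RealLabelsLicenceGenuineK
import HarnessLib

/-!
# D-0079 RESCUE sub-cell R-H, ROUND 1 (director-abc 15:32:46Z, D-0107), ROW 4 «hull-threshold-exact» — the deciding declaration H⋆₄
# typed over the genuine bed `Thm311.Real.settingPrVolSharp (Cor312Prov.pilotDataOfK D K) …`, and its CONJECTURED CLOSED-FORM COLUMN

abc-iut cell, rung LADDER-ABC:A2.RESCUE.H; seat abc-iut-rh-typ-4 (R-H ROUND 1 PAIR n = 4, TYPER; tester abc-iut-rh-tst-4; k2 desk hand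
abc-iut-rp-d1 g4). Row 4 of `plan/rescue/R-H/RH-CANDIDATES.tsv` v1 (sha16 f7773e15cd7f6906), informal statement quoted VERBATIM:
«forall bad w, j: ||t_q|| <= nu_{j,p}(w) (orbit sup-norm of the (Ind1)(Ind2)-images), equivalently v_p(t_q) + sum_i beta_i >=
floor(v_p(t_Theta) - (d_I - min_J d_{L_J}) - sum_i alpha_i) (C-R30 (2)); in I06* currency h(w,j) <= kappa_hull(w,j) — DECLARED
licence-cell-renamed (k4 allowed); content = the CLOSED FORM of kappa_hull at wild packets in (e_w, d_w, r_in, r_out, f_w, j)».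
HONEST FRAMING: H⋆₄ is an R-H CANDIDATE HYPOTHESIS about OUR typed hull (claim-tagged `def … : Prop`, never a Literature fact, never
asserted); nothing here asserts abc proved or refuted; no side is taken on [IUTchIII] Cor. 3.12 or on any author; typed ≠ proved; evaluated ≠
endorsed; refuted-as-typed ≠ refuted-in-print. Definitions + elementary proofs; standard axioms; everything deep is consumed BY NAME.

## §1 The ν-FORM (the row's first clause) at the sharp print-normalised bed — DECLARED EQUIVALENT to the per-datum S_H antecedent
`HStarNu X … tq t …` := «at every prime `p` and label `j`, for every summand `v⃗ : Caps j → Fibre p` and every field factor `i`, some point `z`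
of `⋃₀ possibleImages j p` has `‖t_{q,v_j}‖ ≤ ‖ψ_{v⃗}(z)_i‖» — abc-iut-rp-d1's typing of «‖t_q‖ ≤ ν_{j,p}(w)» (ν = the orbit sup-norm, a max:
`Cor312LicenceCellThreshold`, p455685 ✓ / p457117 ✓). `pilotKummerCompatHull_iff_hStarNu` := rp-d1's `pilotKummerCompatHull_settingPrVolSharp_iff_cells`
BY NAME: under the q-pin, «QPinned ∧ PilotKummerCompatHull» (binder `hSHw` of the window certificates, constant reading included) ⟺ H⋆₄.
This is the k2 door (c) of START-HERE A2 and the DECLARED k4 equivalence (allowed as declared: START-HERE §3 k4-amended). `X := pilotDataOfK D K`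
is the genuine bed (§3).

## §2 The CLOSED-FORM COLUMN (the row's «content», CONJECTURED formula of record for k1; integers, `w`-units)
`HullCell e m j r_in r_out :⟺ e·⌊(j²·m − j·(e−1) − (j+1)·r_in)/e⌋ ≤ m − (j+1)·r_out` — the exact per-summand criterion of abc-iut-c312-5
(`Literature.IUT.LogVolume.iota_smul_subset_packetHull_orbit_iota_smul_iff`, `TensorPacketLicenceExact`, PROVED at the packet-algebra level:
q-box ⊆ hull((Ind2)-orbit of Θ-box) ⟺ `v_p(t_q) − Σ_i β_i ≥ m_Θ := ⌊v_p(t_Θ) − (d_I − min_J d_{L_J}) − Σ_i α_i⌋`, `ρ_in = ‖ϖ‖^{r_in} = p^{−α}`,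
`ρ_out = ‖ϖ‖^{r_out} = p^{−β}`) READ at the DIAGONAL summand of `j+1` factors `≅ K_w` with `K_w` CLASSICALLY TAME (`p ∤ e_w`, so `d_w = (e_w−1)/e_w`
and `d_I − min_J d_{L_J} = j·d_w`), REALISING ideles (`m_Θ-depth = j²·m_q`, `v_p(t_q) = m_q/e_w`). SIGN NOTE: the q-side reads `v_p(t_q) − Σβ`
(hull radius `p^{−m_Θ}·∏ρ_out`); at `r_in = r_out = 1` the cell IS abc-iut-w5-d180's exact tame dichotomy `e·⌊(j²m−1)/e⌋ + 1 − j(e−1) ≤ m`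
(`hullCell_one_one_iff`, `Cor312LicenceExplicitDepthExact`) — the calibration of the sign and of the different term.
MONOTONICITY (`hullCell_mono_rin`, `hullCell_anti_rout`) + the CERTIFIED radii sandwich `r_out_lb := min_{t≥0}(p^t − t·e) ≤ r_out ≤ r_in ≤ r_in_ub :=
⌊e/(p−1)⌋+1` (abc-iut-rp-x2 `CandInternal2RealSharp` p454995; abc-iut-rp-d2 `CandInternal2RealStrata.pBall_subset_logUnits_of_lt` p451708) give the
THREE-VALUED decision `not_hullCell_of_bounds` / `hullCell_of_bounds` used by the k1 column (HOME/abc-iut-rh-typ-4/ROW4-K1-hull-threshold-exact.tsv).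
CONJECTURAL STATUS (flagged): (i) the identification of the setting-level Θ-box / (Ind2) / hull at `(j, p, v⃗)` with c312-5's packet-level
`iota • normalizedPacket` / `indTwo` / `packetHull` is R-W's U2-LICENCE-WRAPPER (abc-iut-w4-d036, not landed) — until then `HullCell` is a
CONJECTURED column formula, not a theorem about `settingPrVolSharp`; (ii) exactness of `(r_in_ub, r_out_lb)` at a genuine completion is
R-W's U2-LATTICE-INTEGERS (abc-iut-s2-p12). §3 `HStarClosedForm X rin rout` := the closed-form reading at a Dupuy–Hilado datum with the radii
supplied per place as DATA (hypotheses by name, the p448597 → p449282 pattern); §4 row instances by `decide`.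
[cite: Mochizuki2012, IUTchIII Cor. 3.12 p. 173–174, Step (xi-f) p. 184, Rmk. 3.12.2 (ii) p. 175; IUTchIV Prop. 1.2 (i)(ii) p. 10, Prop. 1.4 p. 13]
[cite: DupuyHilado2025, §3.4, §4.9, §4.12] [cite: MochizukiAbsTopIII2015, Def 5.4 (iii) p. 126] [claim: Mochizuki2012, status: disputed] for every
IUT locution quoted. Axioms: standard.
-/

noncomputable section

open Set Function NumberField IsDedekindDomain
open scoped Pointwise

namespace Summit.ABC.IUTFork.Repair.RH.HullThresholdExact

open Summit.ABC.IUTFork.Thm311 Summit.ABC.IUTFork.Thm311.Real Summit.ABC.IUTFork.Cor312 Summit.ABC.IUTFork.Cor312.Setting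
  Summit.ABC.IUTFork.Cor312Vol Summit.ABC.IUTFork.Cor312Prov Literature.IUT.LogThetaLattice Literature.IUT.LogVolume
  Literature.IUT.HodgeTheaters

/-! ## §1. The ν-form H⋆₄ at the sharp print-normalised bed and its DECLARED equivalence with the per-datum S_H antecedent -/

section NuForm

variable {F : Type} [Field F] [NumberField F] (X : PilotData F) {logv : PadicLogs F} (hlog : LogvAnalytic logv)
  (M : Type) [Field M] [NumberField M]
  (archPk : ∀ (j : (thetaIndex X).Label) (vQ : (thetaIndex X).VQ), Set ((logShellsDH X logv).Packet j vQ))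
  (archSub : ∀ (j : (thetaIndex X).Label) (v : (thetaIndex X).V),
    Set ((logShellsDH X logv).Packet j ((thetaIndex X).over v)))
  (Ψ : ℤ → ∀ v : (thetaIndex X).V, v ∈ (thetaIndex X).Vbad → Set ((logShellsDH X logv).StarPacket v))
  (act : ℤ → ∀ v : (thetaIndex X).V, v ∈ (thetaIndex X).Vbad →
    (logShellsDH X logv).StarPacket v → Module.End ℚ ((logShellsDH X logv).StarPacket v))
  (Mmod : ℤ → ∀ j : (thetaIndex X).LabelStar, Set ((logShellsDH X logv).GlobalPacket j.1))
  (region : ℤ → ∀ j : (thetaIndex X).LabelStar, FinDivisor M → ∀ vQ : (thetaIndex X).VQ,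
    Set ((logShellsDH X logv).Packet j.1 vQ))
  (n : ℤ) {HT : Type} {LogLink : HT → HT → Type} {IsFull : ∀ {s t : HT}, LogLink s t → Prop}
  (lat : LGPGaussianLogThetaLattice LogLink IsFull)
  {Frd : Type} {IsoF : Frd → Frd → Type} {Ob : Frd → Type} {realify : Frd → Frd} {Strip : Type}
  {IsoS : Strip → Strip → Type} {Mv : ∀ v : (thetaIndex X).V, v ∈ (thetaIndex X).Vbad → Type}
  [∀ v h, Monoid (Mv v h)]
  (sig : GlobalLGPFrobenioidSignature (thetaIndex X).lstar (thetaIndex X).V (· ∈ (thetaIndex X).Vbad)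
    Frd IsoF Ob realify Strip IsoS Mv)
  (split : SplittingMonoids Mv) {ObΔ : Type} {N : ∀ v : (thetaIndex X).V, v ∈ (thetaIndex X).Vbad → Type}
  [∀ v h, Monoid (N v h)] (qData : QPilotData ObΔ N)
  (tq : ∀ (pp : Nat.Primes) (x : (thetaIndex X).Fibre (.inr pp)), haveI : Fact (pp : ℕ).Prime := ⟨pp.2⟩; kOf X pp.1 x)
  (t : ∀ (pp : Nat.Primes) (_ : Fin X.lstar) (x : (thetaIndex X).Fibre (.inr pp)),
    haveI : Fact (pp : ℕ).Prime := ⟨pp.2⟩; kOf X pp.1 x)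
  (htq0 : ∀ pp x, tq pp x ≠ 0)
  (htq1 : ∀ (pp : Nat.Primes) (x : (thetaIndex X).Fibre (.inr pp)),
    haveI : Fact (pp : ℕ).Prime := ⟨pp.2⟩; placeOf X pp.1 x ∉ X.S → ‖tq pp x‖ = 1)

/-- **H⋆₄, ν-form** («hull-threshold-exact», RH-CANDIDATES row 4, first clause): at every prime `p` and label `j` of the sharp print-normalised
setting of the Dupuy–Hilado datum `X` (genuine bed: `X := Cor312Prov.pilotDataOfK D K`), for every summand `v⃗` of the tensor packet and every
field factor `i`, the q-idele at the last slot is dominated in norm by SOME point of the union of the possible (Ind1)(Ind2)-images of the Θ-pilot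
region in that coordinate: «`‖t_{q,v_j}‖ ≤ ν_{j,p}(v⃗, i)`», `ν` the orbit sup-norm (abc-iut-rp-d1's typing, `Cor312LicenceCellThreshold`).
R-H CANDIDATE HYPOTHESIS — not a fact; DECLARED equivalent to the licence cells (`pilotKummerCompatHull_iff_hStarNu`).
[claim: Mochizuki2012, status: disputed] -/
@[claim "Mochizuki2012" "disputed"]
def HStarNu : Prop :=
  ∀ (pp : Nat.Primes) (j : (thetaIndex X).Label),
    haveI : Fact (pp : ℕ).Prime := ⟨pp.2⟩
    ∀ (e : (thetaIndex X).Caps j → (thetaIndex X).Fibre (.inr pp)) (i : DIdx (pp : ℕ) ((presAt X hlog pp).kk e)),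
      ∃ z ∈ ⋃₀ (settingPrVolSharp X hlog M archPk archSub Ψ act Mmod region n lat sig split qData tq t htq0 htq1).possibleImages
        j (.inr pp), ‖tq pp (e (Fin.last _))‖ ≤ ‖(presAt X hlog pp).factorMap j z ⟨e, i⟩‖

/-- **k2 door (c) / k4 DECLARED EQUIVALENCE, BY NAME** (abc-iut-rp-d1 `pilotKummerCompatHull_settingPrVolSharp_iff_cells`, p457117 ✓): for
Θ-ideles `t ≠ 0` and ANY columns `col`, region-forming `ρ` and q-datum `qK` satisfying the q-pin (in particular the window certificates' constant
reading, binder `hSHw`), `PilotKummerCompatHull` at `settingPrVolSharp X …` ⟺ `HStarNu X …`. [claim: Mochizuki2012, status: disputed] -/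
theorem pilotKummerCompatHull_iff_hStarNu (ht0 : ∀ pp i x, t pp i x ≠ 0) (col : ℤ → Column (logShellsDH X logv))
    (ρ : (∀ v : (thetaIndex X).V, v ∈ (thetaIndex X).Vbad → Set ((logShellsDH X logv).StarPacket v)) →
      ∀ (j : (thetaIndex X).Label) (vQ : (thetaIndex X).VQ), Set ((logShellsDH X logv).Packet j vQ))
    (qK : ∀ v : (thetaIndex X).V, v ∈ (thetaIndex X).Vbad → Set ((logShellsDH X logv).StarPacket v))
    (hq : QPinned ({ toSituation := situationPrVol X hlog M archPk archSub Ψ act Mmod region, col := col } :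
        LatticeSituation (thetaIndex X))
      (settingPrVolSharp X hlog M archPk archSub Ψ act Mmod region n lat sig split qData tq t htq0 htq1) ρ qK) :
    PilotKummerCompatHull ({ toSituation := situationPrVol X hlog M archPk archSub Ψ act Mmod region, col := col } :
        LatticeSituation (thetaIndex X))
      (settingPrVolSharp X hlog M archPk archSub Ψ act Mmod region n lat sig split qData tq t htq0 htq1) ρ qK ↔
      HStarNu X hlog M archPk archSub Ψ act Mmod region n lat sig split qData tq t htq0 htq1 :=
  pilotKummerCompatHull_settingPrVolSharp_iff_cells X hlog M archPk archSub Ψ act Mmod region n lat sig split qData tq t htq0 htq1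
    ht0 col ρ qK hq

/-- Hence **H⋆₄ ⟹ the per-datum S_H antecedent** (binder `hSHw`-shape) at the bed, for every admissible `(col, ρ, qK)` with the q-pin.
[claim: Mochizuki2012, status: disputed] -/
theorem pilotKummerCompatHull_of_hStarNu (ht0 : ∀ pp i x, t pp i x ≠ 0) (col : ℤ → Column (logShellsDH X logv))
    (ρ : (∀ v : (thetaIndex X).V, v ∈ (thetaIndex X).Vbad → Set ((logShellsDH X logv).StarPacket v)) →
      ∀ (j : (thetaIndex X).Label) (vQ : (thetaIndex X).VQ), Set ((logShellsDH X logv).Packet j vQ))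
    (qK : ∀ v : (thetaIndex X).V, v ∈ (thetaIndex X).Vbad → Set ((logShellsDH X logv).StarPacket v))
    (hq : QPinned ({ toSituation := situationPrVol X hlog M archPk archSub Ψ act Mmod region, col := col } :
        LatticeSituation (thetaIndex X))
      (settingPrVolSharp X hlog M archPk archSub Ψ act Mmod region n lat sig split qData tq t htq0 htq1) ρ qK)
    (h : HStarNu X hlog M archPk archSub Ψ act Mmod region n lat sig split qData tq t htq0 htq1) :
    PilotKummerCompatHull ({ toSituation := situationPrVol X hlog M archPk archSub Ψ act Mmod region, col := col } :
        LatticeSituation (thetaIndex X))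
      (settingPrVolSharp X hlog M archPk archSub Ψ act Mmod region n lat sig split qData tq t htq0 htq1) ρ qK :=
  (pilotKummerCompatHull_iff_hStarNu X hlog M archPk archSub Ψ act Mmod region n lat sig split qData tq t htq0 htq1 ht0 col ρ qK hq).2 h

end NuForm

/-! ## §2. The closed-form column `HullCell` (integers, `w`-units) -/

/-- **The CONJECTURED CLOSED FORM of the licence cell** at a bad place `w` (ramification index `e = e_w`, q-depth `m = m_q = ord_w(q̲)` in
`ϖ_w`-units, label `j`, inner/outer radii exponents `r_in`, `r_out` of `Λ_w = log_p(𝒪^×_{K_w})`: `𝔪^{r_in} ⊆ Λ_w ⊆ 𝔪^{r_out}` optimally):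
`e·⌊(j²·m − j·(e−1) − (j+1)·r_in)/e⌋ ≤ m − (j+1)·r_out` — c312-5's exact criterion «`v_p(t_q) − Σβ_i ≥ ⌊v_p(t_Θ) − (d_I − min_J d_{L_J}) − Σα_i⌋`»
read at the diagonal packet of `j+1` classically tame factors `K_w` (`d_I − min d_L = j(e−1)/e`) with realising ideles (`v_p(t_Θ) = j²·m/e`). `/` is
`Int.ediv` = floor for `e > 0`. R-H row 4's CONTENT — a conjectured COLUMN FORMULA, not a theorem about the typed setting (module docstring (i)(ii)).
[claim: Mochizuki2012, status: disputed] -/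
@[claim "Mochizuki2012" "disputed"]
def HullCell (e m j rin rout : ℤ) : Prop :=
  e * ((j ^ 2 * m - j * (e - 1) - (j + 1) * rin) / e) ≤ m - (j + 1) * rout

/-- **CALIBRATION: at a tame place (`r_in = r_out = 1`, `Λ_w = 𝔪_w`) the closed form IS abc-iut-w5-d180's exact tame dichotomy**
«`e·⌊(j²m − 1)/e⌋ + 1 − j(e−1) ≤ m`» (`Cor312LicenceExplicitDepthExact`; genuine form p449282) — fixes the sign of the `Σβ` term and the
different term `j(e−1)/e`. Pure integer arithmetic (`e ≠ 0`). [folklore] -/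
theorem hullCell_one_one_iff {e : ℤ} (he : e ≠ 0) (m j : ℤ) :
    HullCell e m j 1 1 ↔ e * ((j ^ 2 * m - 1) / e) + 1 - j * (e - 1) ≤ m := by
  have hq : (j ^ 2 * m - j * (e - 1) - (j + 1) * 1) / e = (j ^ 2 * m - 1) / e - j := by
    rw [show j ^ 2 * m - j * (e - 1) - (j + 1) * 1 = (j ^ 2 * m - 1) + (-j) * e by ring, Int.add_mul_ediv_right _ _ he]
    ring
  unfold HullCell
  rw [hq, mul_sub]
  constructor <;> intro h <;> linarith

/-- **Monotone in the inner exponent**: a SMALLER inner ball (`r_in ≤ r_in'`) lowers the content of the Θ-box, enlarges the orbit hull, and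
keeps the cell (`0 < e`, `0 ≤ j + 1`). [folklore] -/
theorem hullCell_mono_rin {e m j rin rin' rout : ℤ} (he : 0 < e) (hj : 0 ≤ j + 1) (h : rin ≤ rin') (hc : HullCell e m j rin rout) :
    HullCell e m j rin' rout := by
  unfold HullCell at hc ⊢
  have hle : j ^ 2 * m - j * (e - 1) - (j + 1) * rin' ≤ j ^ 2 * m - j * (e - 1) - (j + 1) * rin := by
    nlinarith [mul_le_mul_of_nonneg_left h hj]
  have hdiv := Int.ediv_le_ediv he hle
  nlinarith [mul_le_mul_of_nonneg_left hdiv he.le]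

/-- **Antitone in the outer exponent**: a LARGER shell (`r_out ≤ r_out'` fails ⇒ …) — if the cell holds with outer exponent `r_out'` it holds with
any `r_out ≤ r_out'` (`0 ≤ j + 1`). [folklore] -/
theorem hullCell_anti_rout {e m j rin rout rout' : ℤ} (hj : 0 ≤ j + 1) (h : rout ≤ rout') (hc : HullCell e m j rin rout') :
    HullCell e m j rin rout := by
  unfold HullCell at hc ⊢
  nlinarith [mul_le_mul_of_nonneg_left h hj]

/-- **NEG-CERTIFIED cells**: with CERTIFIED bounds `r_in ≤ r_in_ub` (`𝔪^{r_in_ub} ⊆ Λ_w`, p451708) and `r_out_lb ≤ r_out` (`Λ_w ⊆ 𝔪^{r_out_lb}`,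
p454995), failure of the closed form at the MOST FAVOURABLE pair `(r_in_ub, r_out_lb)` forces failure at the true radii. [folklore] -/
theorem not_hullCell_of_bounds {e m j rin rout rinUb routLb : ℤ} (he : 0 < e) (hj : 0 ≤ j + 1) (hrin : rin ≤ rinUb)
    (hrout : routLb ≤ rout) (hneg : ¬ HullCell e m j rinUb routLb) : ¬ HullCell e m j rin rout := fun hc =>
  hneg (hullCell_mono_rin he hj hrin (hullCell_anti_rout hj hrout hc))

/-- **POS-CERTIFIED cells**: since `r_out ≤ r_in` (`𝔪^{r_in} ⊆ Λ_w ⊆ 𝔪^{r_out}`), the true pair is sandwiched `r_out_lb ≤ r_out ≤ r_in ≤ r_in_ub`;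
if the closed form holds at the LEAST FAVOURABLE pair `(r_in := r_out_lb, r_out := r_in_ub)` it holds at the true radii. [folklore] -/
theorem hullCell_of_bounds {e m j rin rout rinUb routLb : ℤ} (he : 0 < e) (hj : 0 ≤ j + 1) (hrout : routLb ≤ rout) (hio : rout ≤ rin)
    (hrin : rin ≤ rinUb) (hpos : HullCell e m j routLb rinUb) : HullCell e m j rin rout :=
  hullCell_anti_rout hj (hio.trans hrin) (hullCell_mono_rin he hj (hrout.trans hio) hpos)

/-! ## §3. The closed-form reading AT A DUPUY–HILADO DATUM (genuine bed `X := pilotDataOfK D K`), radii supplied per place as data -/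

section Genuine

variable {F : Type} [Field F] [NumberField F] (X : PilotData F)
  (rin rout : ∀ pp : Nat.Primes, (thetaIndex X).Fibre (.inr pp) → ℤ)

/-- **H⋆₄, closed-form reading at the datum `X`** (intended `X := Cor312Prov.pilotDataOfK D K`, [IUTchI] Def. 3.1 initial Θ-data `D`; the
radii `rin pp w = r_in(K_w)`, `rout pp w = r_out(K_w)` of `log_p(𝒪^×_{K_w})` are DATA supplied per bad place — R-W U2-LATTICE-INTEGERS): at every
prime `p`, every bad place `w | p` of `X` with integral pilot degree `P_q(w) = P` (`Cor312Prov.exists_nat_qPilot_pilotDataOfK`) and every label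
`j = i + 1 ∈ 𝔽_l^⋇`, `HullCell e_w P (i+1) (rin w) (rout w)`. CONJECTURED to coincide with `HStarNu` cell by cell at classically tame `K_w`
(U2-LICENCE-WRAPPER pending); R-H candidate hypothesis, never asserted. [claim: Mochizuki2012, status: disputed] -/
@[claim "Mochizuki2012" "disputed"]
def HStarClosedForm : Prop :=
  ∀ (pp : Nat.Primes) (i : Fin X.lstar) (w : (thetaIndex X).Fibre (.inr pp)),
    haveI : Fact (pp : ℕ).Prime := ⟨pp.2⟩
    placeOf X pp.1 w ∈ X.S → ∀ P : ℕ, X.qPilot (placeOf X pp.1 w) = P →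
      HullCell ((placeOf X pp.1 w).asIdeal.ramificationIdx ℤ : ℤ) (P : ℤ) ((i : ℕ) + 1 : ℤ) (rin pp w) (rout pp w)

/-- The closed-form reading at the GENUINE `K`-level datum of a collection of initial Θ-data (`Cor312Prov.pilotDataOfK D K`), for the record:
it is `HStarClosedForm (pilotDataOfK D K) rin rout`, and at every bad place the pilot degree IS a positive integer (`exists_nat_qPilot_pilotDataOfK`),
so the `∀ P` binder is never vacuous there. [cite: Mochizuki2012, IUTchI Ex. 3.2 (iv) p. 71] [claim: Mochizuki2012, status: disputed] -/
theorem hStarClosedForm_pilotDataOfK_cell {K Fbar : Type} [Field K] [NumberField K] [Algebra F K] [Field Fbar] [Algebra F Fbar]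
    [Algebra K Fbar] {E : WeierstrassCurve F} [E.IsElliptic] {l : ℕ} {Pb : BadPlacePredicates K} (D : InitialThetaData F K Fbar E l Pb)
    (rinK routK : ∀ pp : Nat.Primes, (thetaIndex (pilotDataOfK D K)).Fibre (.inr pp) → ℤ)
    (h : HStarClosedForm (pilotDataOfK D K) rinK routK) (pp : Nat.Primes) (i : Fin (pilotDataOfK D K).lstar)
    (w : (thetaIndex (pilotDataOfK D K)).Fibre (.inr pp))
    (hw : haveI : Fact (pp : ℕ).Prime := ⟨pp.2⟩; placeOf (pilotDataOfK D K) pp.1 w ∈ (pilotDataOfK D K).S) :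
    haveI : Fact (pp : ℕ).Prime := ⟨pp.2⟩
    ∃ P : ℕ, (pilotDataOfK D K).qPilot (placeOf (pilotDataOfK D K) pp.1 w) = P ∧ 1 ≤ P ∧
      HullCell ((placeOf (pilotDataOfK D K) pp.1 w).asIdeal.ramificationIdx ℤ : ℤ) (P : ℤ) ((i : ℕ) + 1 : ℤ) (rinK pp w) (routK pp w) := by
  haveI : Fact (pp : ℕ).Prime := ⟨pp.2⟩
  obtain ⟨P, hP, hP1, -⟩ := exists_nat_qPilot_pilotDataOfK D hw
  exact ⟨P, hP, hP1, h pp i w hw P hP⟩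

end Genuine

/-! ## §4. Row instances of the column (k1 evidence; `w`-units; certified radii bounds `r_in_ub = ⌊e/(p−1)⌋+1`, `r_out_lb = min_t(p^t − t·e)`) -/

/-- **TAME calibration rows** (`r_in = r_out = 1`): S-X75 / X75i (`e = 5, m = 1, l = 5`): POS at `j = 1, 2`; S-X72 (`e = 2, m = 1`): POS at `j = 2`
(licence INHABITED, p442550 — the k4 separating cell vs I06⋆, which is NEG there); `F = ℚ` (`e = 1`): NEG at `j = 2`. [folklore] -/
theorem rows_tame : HullCell 5 1 1 1 1 ∧ HullCell 5 1 2 1 1 ∧ HullCell 2 1 2 1 1 ∧ ¬ HullCell 1 1 2 1 1 := by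
  unfold HullCell; decide

/-- **HEX λ_k, k = 5, l = 29, local type e(v|7) = 1** (`p = 7, e_w = 29, m_q = 5`, top label `j = 14`; `r_in_ub = 5`, `r_out_lb = 7 − 29 = −22`):
the closed form FAILS even at the most favourable radii ⇒ NEG-certified for the column — a row R-W's [ED] engine leaves in the WINDOW
(`margin_ED = 396/29 > 0`). [folklore] -/
theorem row_hex_k5_l29_ev1 : ¬ HullCell 29 5 14 5 (-22) := by
  unfold HullCell; decide

/-- **HEX λ_k, k = 9, l = 53, e(v|7) = 30** (`e_w = 1590, m_q = 270`, `j = 26`; `r_in_ub = 266`, `r_out_lb = 343 − 3·1590 = −4427`): NEG-certified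
(R-W: WINDOW, `margin_ED > 0`). [folklore] -/
theorem row_hex_k9_l53_ev30 : ¬ HullCell 1590 270 26 266 (-4427) := by
  unfold HullCell; decide

/-- **HEX λ_k, k = 1, l = 11, e(v|7) = 1** (`e_w = 11, m_q = 1`, labels `j ≤ 5`; `r_in_ub = 2`, `r_out_lb = 7 − 11 = −4`): POS-CERTIFIED for the
column — the closed form holds at EVERY label even at the least favourable admissible pair `(r_in, r_out) = (−4, 2)` (the only POS-certified
group of the v1 `lamSeven` block). [folklore] -/
theorem row_hex_k1_l11_ev1 :
    HullCell 11 1 1 (-4) 2 ∧ HullCell 11 1 2 (-4) 2 ∧ HullCell 11 1 3 (-4) 2 ∧ HullCell 11 1 4 (-4) 2 ∧ HullCell 11 1 5 (-4) 2 := by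
  unfold HullCell; decide

/-- **HEX λ_k, k = 1, l = 13, e(v|7) = 1** (`e_w = 13, m_q = 1`, labels `j ≤ 6`; `r_in_ub = 3`, `r_out_lb = −6`): OPEN for the column — holds at the
favourable pair `(3, −6)` at every label, fails at the unfavourable pair `(−6, 3)` at the top label. [folklore] -/
theorem row_hex_k1_l13_ev1 :
    (HullCell 13 1 1 3 (-6) ∧ HullCell 13 1 2 3 (-6) ∧ HullCell 13 1 3 3 (-6) ∧ HullCell 13 1 4 3 (-6) ∧ HullCell 13 1 5 3 (-6) ∧
        HullCell 13 1 6 3 (-6)) ∧ ¬ HullCell 13 1 6 (-6) 3 := by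
  unfold HullCell; decide

/-- **Dupuy–Hilado I v2 §2.10, `11a1`, `l = 13`, `p = 11`** (`e_w = 78`, `m_q = 15`, top `j = 6`; `r_in_ub = 8`, `r_out_lb = 11 − 78 = −67`): OPEN for
the column (holds at `(8, −67)`, fails at `(−67, 8)`); I06⋆ is NEG there (`EvalI06StarDH11a1.not_allLabels`). [folklore] -/
theorem row_dh11a1 : HullCell 78 15 6 8 (-67) ∧ ¬ HullCell 78 15 6 (-67) 8 := by
  unfold HullCell; decide


/-! ## §5. (APPENDED, v2) The ARITHMETIC BRIDGE from c312-5's real-valued criterion to the integer column `HullCell`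

The RHS of `Literature.IUT.LogVolume.iota_smul_subset_packetHull_orbit_iota_smul_iff` has the shape
`∀ m : ℤ, (∀ J, p^m·‖t_Θ‖ ≤ p^{−D_J}·Π_in) → p^m·‖t_q‖ ≤ Π_out` (`Π_in = ∏‖c^in_i‖`, `Π_out = ∏‖c^out_i‖`, `D_J = d_I − d_{L_J}`). The two
lemmas below turn BOUNDS on `Π_in`, `Π_out`, `D_J` and the realising norms `‖t_q‖ = p^{−m_q/e}`, `‖t_Θ‖ = p^{−j²m_q/e}` into the three-valued
`HullCell` decision — pure real/integer arithmetic, no packet vocabulary: the last step of the pending setting-level wrapper (R-W U2-LICENCE-WRAPPER)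
for BOTH directions. NEG: lower bound on `Π_in` (`≥ p^{−(j+1)·r_in_ub/e}`), upper bound on `Π_out` (`≤ p^{−(j+1)·r_out_lb/e}`), `D_J ≤ j(e−1)/e`
for all `J`, and `¬ HullCell e m_q j r_in_ub r_out_lb` ⟹ the criterion FAILS. POS: `Π_in ≤ p^{−(j+1)·r_in'/e}`, `p^{−(j+1)·r_out'/e} ≤ Π_out`,
`D_{J₀} = j(e−1)/e` at SOME `J₀`, and `HullCell e m_q j r_in' r_out'` ⟹ the criterion HOLDS. -/

section Bridge

variable {ι : Type} {p : ℕ}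

/-- `p^m = p^{(e·m)/e}` as a real power (`e ≠ 0`). [folklore] -/
private theorem zpow_eq_rpow_div {e : ℤ} (he : e ≠ 0) (m : ℤ) :
    ((p : ℝ) ^ m : ℝ) = (p : ℝ) ^ (((e * m : ℤ) : ℝ) / (e : ℝ)) := by
  have he' : ((e : ℤ) : ℝ) ≠ 0 := by exact_mod_cast he
  rw [← Real.rpow_intCast]
  congr 1
  push_cast
  field_simp

/-- `p^{X/e} · p^{Y/e} = p^{(X+Y)/e}`. [folklore] -/
private theorem rpow_div_mul_rpow_div (hp : 0 < p) (e : ℤ) (X Y : ℝ) :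
    (p : ℝ) ^ (X / (e : ℝ)) * (p : ℝ) ^ (Y / (e : ℝ)) = (p : ℝ) ^ ((X + Y) / (e : ℝ)) := by
  have hp0 : (0 : ℝ) < p := by exact_mod_cast hp
  rw [← Real.rpow_add hp0, add_div]

/-- `p^{X/e} ≤ p^{Y/e} ⟺ X ≤ Y` for `p > 1`, `e > 0`. [folklore] -/
private theorem rpow_div_le_iff (hp : 1 < p) {e : ℤ} (he : 0 < e) (X Y : ℝ) :
    (p : ℝ) ^ (X / (e : ℝ)) ≤ (p : ℝ) ^ (Y / (e : ℝ)) ↔ X ≤ Y := by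
  have hp1 : (1 : ℝ) < p := by exact_mod_cast hp
  have he0 : (0 : ℝ) < (e : ℝ) := by exact_mod_cast he
  rw [Real.rpow_le_rpow_left_iff hp1, div_le_div_iff_of_pos_right he0]

/-- **NEG BRIDGE.** If the integer column fails at the most favourable certified radii, c312-5's criterion fails: with `‖t_q‖ = p^{−m_q/e}`,
`‖t_Θ‖ = p^{−j²m_q/e}`, inner product `Π_in ≥ p^{−(j+1)r_in_ub/e}`, outer product `Π_out ≤ p^{−(j+1)r_out_lb/e}`, all different defects
`D_J ≤ j(e−1)/e` (`0 < e`), `¬ HullCell e m_q j r_in_ub r_out_lb` ⟹ `¬ ∀ m, (∀ J, p^m‖t_Θ‖ ≤ p^{−D_J}Π_in) → p^m‖t_q‖ ≤ Π_out` (witness `m :=` the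
content `⌊(j²m_q − j(e−1) − (j+1)r_in_ub)/e⌋`). [folklore] -/
theorem not_criterion_of_not_hullCell (hp : 1 < p) {e mq j rinUb routLb : ℤ} (he : 0 < e)
    {tq tΘ Pin Pout : ℝ} {D : ι → ℝ}
    (htq : tq = (p : ℝ) ^ (((-mq : ℤ) : ℝ) / (e : ℝ)))
    (htΘ : tΘ = (p : ℝ) ^ (((-(j ^ 2 * mq) : ℤ) : ℝ) / (e : ℝ)))
    (hPin : (p : ℝ) ^ (((-((j + 1) * rinUb) : ℤ) : ℝ) / (e : ℝ)) ≤ Pin)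
    (hPout : Pout ≤ (p : ℝ) ^ (((-((j + 1) * routLb) : ℤ) : ℝ) / (e : ℝ)))
    (hD : ∀ J, D J ≤ ((j * (e - 1) : ℤ) : ℝ) / (e : ℝ))
    (hneg : ¬ HullCell e mq j rinUb routLb) :
    ¬ ∀ m : ℤ, (∀ J, (p : ℝ) ^ m * tΘ ≤ (p : ℝ) ^ (-D J) * Pin) → (p : ℝ) ^ m * tq ≤ Pout := by
  intro h
  have hp0 : 0 < p := by omega
  have hP0 : (0 : ℝ) < p := by exact_mod_cast hp0
  have hp1 : (1 : ℝ) < p := by exact_mod_cast hp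
  have he0 : e ≠ 0 := he.ne'
  set m : ℤ := (j ^ 2 * mq - j * (e - 1) - (j + 1) * rinUb) / e with hm
  -- the floor property of the content and the failure of the cell
  have hme : e * m ≤ j ^ 2 * mq - j * (e - 1) - (j + 1) * rinUb := by
    rw [mul_comm]; exact Int.ediv_mul_le _ he0
  have hlt : mq - (j + 1) * routLb < e * m := by
    unfold HullCell at hneg; rw [← hm] at hneg; exact lt_of_not_ge hneg
  -- the content condition holds at `m`
  have hcont : ∀ J, (p : ℝ) ^ m * tΘ ≤ (p : ℝ) ^ (-D J) * Pin := by
    intro J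
    rw [zpow_eq_rpow_div (p := p) he0 m, htΘ, rpow_div_mul_rpow_div hp0]
    have h1 : (p : ℝ) ^ ((((e * m : ℤ) : ℝ) + ((-(j ^ 2 * mq) : ℤ) : ℝ)) / (e : ℝ)) ≤
        (p : ℝ) ^ ((((-(j * (e - 1)) : ℤ) : ℝ) + ((-((j + 1) * rinUb) : ℤ) : ℝ)) / (e : ℝ)) := by
      rw [rpow_div_le_iff hp he]
      exact_mod_cast (by linarith : e * m + -(j ^ 2 * mq) ≤ -(j * (e - 1)) + -((j + 1) * rinUb))
    have h2 : (p : ℝ) ^ ((((-(j * (e - 1)) : ℤ) : ℝ) + ((-((j + 1) * rinUb) : ℤ) : ℝ)) / (e : ℝ)) ≤ (p : ℝ) ^ (-D J) * Pin := by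
      rw [← rpow_div_mul_rpow_div hp0]
      have hDJ : (p : ℝ) ^ ((((-(j * (e - 1)) : ℤ) : ℝ)) / (e : ℝ)) ≤ (p : ℝ) ^ (-D J) := by
        apply Real.rpow_le_rpow_of_exponent_le hp1.le
        have := hD J
        have he1 : (0 : ℝ) < (e : ℝ) := by exact_mod_cast he
        rw [show ((((-(j * (e - 1)) : ℤ) : ℝ)) / (e : ℝ)) = -(((j * (e - 1) : ℤ) : ℝ) / (e : ℝ)) by push_cast; ring]
        linarith
      exact mul_le_mul hDJ hPin (Real.rpow_nonneg hP0.le _) (Real.rpow_nonneg hP0.le _)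
    exact h1.trans h2
  -- hence the q-condition at `m`, contradicting the failure of the cell
  have hq := (h m hcont).trans hPout
  rw [zpow_eq_rpow_div (p := p) he0 m, htq, rpow_div_mul_rpow_div hp0, rpow_div_le_iff hp he] at hq
  have hq' : e * m + -mq ≤ -((j + 1) * routLb) := by exact_mod_cast hq
  linarith

/-- **POS BRIDGE.** If the integer column holds at radii `(r_in', r_out')` with `Π_in ≤ p^{−(j+1)r_in'/e}` (the true inner product is at most this),
`p^{−(j+1)r_out'/e} ≤ Π_out`, and the different defect is ATTAINED `D_{J₀} = j(e−1)/e` at some `J₀` (the diagonal factor `L_{J₀} ≅ K_w`), then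
c312-5's criterion holds (`0 < e`). [folklore] -/
theorem criterion_of_hullCell (hp : 1 < p) {e mq j rin rout : ℤ} (he : 0 < e)
    {tq tΘ Pin Pout : ℝ} {D : ι → ℝ}
    (htq : tq = (p : ℝ) ^ (((-mq : ℤ) : ℝ) / (e : ℝ)))
    (htΘ : tΘ = (p : ℝ) ^ (((-(j ^ 2 * mq) : ℤ) : ℝ) / (e : ℝ)))
    (hPin : Pin ≤ (p : ℝ) ^ (((-((j + 1) * rin) : ℤ) : ℝ) / (e : ℝ)))
    (hPout : (p : ℝ) ^ (((-((j + 1) * rout) : ℤ) : ℝ) / (e : ℝ)) ≤ Pout)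
    {J₀ : ι} (hD : D J₀ = ((j * (e - 1) : ℤ) : ℝ) / (e : ℝ))
    (hpos : HullCell e mq j rin rout) :
    ∀ m : ℤ, (∀ J, (p : ℝ) ^ m * tΘ ≤ (p : ℝ) ^ (-D J) * Pin) → (p : ℝ) ^ m * tq ≤ Pout := by
  intro m hm
  have hp0 : 0 < p := by omega
  have hP0 : (0 : ℝ) < p := by exact_mod_cast hp0
  have hp1 : (1 : ℝ) < p := by exact_mod_cast hp
  have he0 : e ≠ 0 := he.ne'
  -- from the content condition at `J₀`: `e·m ≤ j²m_q − j(e−1) − (j+1)·r_in'`, hence `m ≤` the content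
  have h0 := hm J₀
  rw [zpow_eq_rpow_div (p := p) he0 m, htΘ, rpow_div_mul_rpow_div hp0, hD,
    show -( ((j * (e - 1) : ℤ) : ℝ) / (e : ℝ)) = (((-(j * (e - 1))) : ℤ) : ℝ) / (e : ℝ) by push_cast; ring] at h0
  have h0' : (p : ℝ) ^ ((((e * m : ℤ) : ℝ) + ((-(j ^ 2 * mq) : ℤ) : ℝ)) / (e : ℝ)) ≤
      (p : ℝ) ^ ((((-(j * (e - 1)) : ℤ) : ℝ) + ((-((j + 1) * rin) : ℤ) : ℝ)) / (e : ℝ)) := by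
    rw [← rpow_div_mul_rpow_div hp0 (e := e) (((-(j * (e - 1)) : ℤ) : ℝ))]
    exact h0.trans (mul_le_mul_of_nonneg_left hPin (Real.rpow_nonneg hP0.le _))
  rw [rpow_div_le_iff hp he] at h0'
  have hint : e * m + -(j ^ 2 * mq) ≤ -(j * (e - 1)) + -((j + 1) * rin) := by exact_mod_cast h0'
  have hmle : m ≤ (j ^ 2 * mq - j * (e - 1) - (j + 1) * rin) / e :=
    Int.le_ediv_of_mul_le he (by linarith)
  -- the cell bounds the content's q-side
  have hcell : e * ((j ^ 2 * mq - j * (e - 1) - (j + 1) * rin) / e) ≤ mq - (j + 1) * rout := hpos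
  have hem : e * m ≤ mq - (j + 1) * rout := le_trans (mul_le_mul_of_nonneg_left hmle he.le) hcell
  rw [zpow_eq_rpow_div (p := p) he0 m, htq, rpow_div_mul_rpow_div hp0]
  refine le_trans ?_ hPout
  rw [rpow_div_le_iff hp he]
  exact_mod_cast (by linarith : e * m + -mq ≤ -((j + 1) * rout))

end Bridge

end Summit.ABC.IUTFork.Repair.RH.HullThresholdExact

end
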